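import Literature.Geometry.Lorentzian.KerrSchildMultiplierCurrent
import Literature.Geometry.Lorentzian.MinkowskiRadialMultiplier

/-! # Route ClusterCompleteness — crux `AdiabaticMultiKerrILED`: ray-level Milne Doppler law
Helper file for the crux `stmt-FinalStateConjecture-14310` (line `Sketch`, lead c6 wave 1, card
milne-hubble-current): two inertial black holes recede from a common event `O` with unit
`4`-velocities `u₁`, `u₂` (`η(u, u) = −1`); a photon with null direction `k` leaves hole `1` at its
proper time `s₁` (event `s₁ u₁`) and reaches hole `2` at its proper time `s₂`
(event `s₂ u₂ = s₁ u₁ + k`). Pairing the vector identity with `k` and using `η(k, k) = 0` gives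
the conservation law `s₂ η(k, u₂) = s₁ η(k, u₁)` ("hole-frame photon energy × proper time is
conserved"); pairing it with itself gives the arrival-time law `s₂² = s₁² − 2 s₁ η(u₁, k)`.
[folklore] -/

noncomputable section

-- the doubled `FinalStateConjecture.FinalStateConjecture` path component trips dupNamespace
set_option linter.dupNamespace false

open scoped BigOperators
open Literature.Geometry.Lorentzian

namespace Summit.FinalStateConjecture.FinalStateConjecture.Theorems

/-- **Ray-level Milne Doppler law.** If a null vector `k` (`η(k, k) = 0`) joins the events
`s₁ u₁` and `s₂ u₂` of two inertial world-lines through a common origin, i.e.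
`s₂ u₂ = s₁ u₁ + k`, then `s₂ η(k, u₂) = s₁ η(k, u₁)`: the product of the hole-frame photon
energy with the hole's proper time is the same at emission and at arrival (pair the vector
identity with `k`). [folklore] -/
theorem doppler_is_time_ratio :
    ∀ (u₁ u₂ k : E4) (s₁ s₂ : ℝ) (hk : Minkowski.bilin k k = 0) (h : s₂ • u₂ = s₁ • u₁ + k),
      s₂ * Minkowski.bilin k u₂ = s₁ * Minkowski.bilin k u₁ := by
  intro u₁ u₂ k s₁ s₂ hk h
  have h' := congrArg (fun v ↦ Minkowski.bilin k v) h
  simp only [map_add, map_smul, smul_eq_mul] at h'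
  linear_combination h' + hk

/-- **Arrival-time law of a null flight between two inertial world-lines through a common
origin.** If `η(u₁, u₁) = η(u₂, u₂) = −1`, `η(k, k) = 0` and `s₂ u₂ = s₁ u₁ + k`, then
`s₂² = s₁² − 2 s₁ η(u₁, k)` (pair the vector identity with itself:
`−s₂² = η(s₂ u₂, s₂ u₂) = s₁² η(u₁, u₁) + 2 s₁ η(u₁, k) + η(k, k) = −s₁² + 2 s₁ η(u₁, k)`).
[folklore] -/
theorem arrival_time_sq :
    ∀ (u₁ u₂ k : E4) (s₁ s₂ : ℝ) (hk : Minkowski.bilin k k = 0) (hu₁ : Minkowski.bilin u₁ u₁ = -1)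
      (hu₂ : Minkowski.bilin u₂ u₂ = -1) (h : s₂ • u₂ = s₁ • u₁ + k),
      s₂ ^ 2 = s₁ ^ 2 - 2 * s₁ * Minkowski.bilin u₁ k := by
  intro u₁ u₂ k s₁ s₂ hk hu₁ hu₂ h
  have h' := congrArg (fun v ↦ Minkowski.bilin v v) h
  simp only [map_add, map_smul, add_apply, smul_apply, smul_eq_mul] at h'
  linear_combination -h' + s₂ ^ 2 * hu₂ - s₁ ^ 2 * hu₁ - hk - s₁ * Minkowski.bilin_symm k u₁

end Summit.FinalStateConjecture.FinalStateConjecture.Theorems
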